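import Literature.IUT.HodgeArakelov.MonoThetaCyclotomes
import Literature.AnabelianGeometry.EtaleTheta.AutOutDictionary
import Literature.AnabelianGeometry.EtaleTheta.ThetaRigidityLevels
import Literature.AnabelianGeometry.EtaleTheta.Discharge.Sec2TowerLemmas

/-!
# Bridge B8: [IUTchII] §1 mono-theta environments (`HodgeArakelov.MonoThetaEnv`) ↔ [EtTh] Def. 2.13 (ii)
# (`EtaleTheta.MonoThetaEnv`, `ThetaEnvData.IsMonoThetaEnv`)

abc-iut cell, MERGE-MAP §8 **B8** (layer L6 ↔ L2). [IUTchII] §1 (kurims p. 20) fixes "the mod `N` model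
mono-theta environment determined by `X̲̲_k`" and calls a *mono-theta environment* any datum
`(Π, D_Π ⊆ Out(Π), s^Θ_Π)` isomorphic to it ([EtTh] Def. 2.13 (ii), p. 47). The cell holds TWO typings:

* abc-iut-L6-t1, `Literature.IUT.HodgeArakelov.MonoThetaCyclotomes` (p405104): `ThetaSetting` carries the
  model as reference fields `modelPi / modelD ⊆ Aut / modelTheta`, and `MonoThetaEnv S` carries
  `D : Subgroup (MulAut Π)` with `D_inn` (contains `Inn Π`), `D_continuous` (homeomorphisms), `theta`,
  and `isModel` (an isomorphism to the reference model);
* abc-iut-L2-t2, `Literature.AnabelianGeometry.EtaleTheta.MonoThetaEnv` (p404894): `MonoThetaEnv` carries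
  `D : Subgroup (TopOut Π)`, `sTheta`; the MODEL `T.modelMono hη` is CONSTRUCTED from `T : ThetaEnvData N`
  ([EtTh] Def. 2.13 (i)(ii): `Π^tp_Y[μ_N]`, `D_Y`, the `μ_N`-conjugacy class of `Im s^Θ`), and
  `T.IsMonoThetaEnv M := ∃ η hη, Nonempty (M.Iso (T.modelMono hη))`.

This file PROVES that the two typings say the same thing:

1. `MonoThetaEnv.toEtale` / `MonoThetaEnv.ofEtale` translate the data (through the `Aut ⊇ Inn` ↔ `Out`
   dictionary of `AutOutDictionary`), inverse to each other ON THE NOSE (`toEtale_ofEtale`,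
   `ofEtale_toEtale`); isomorphisms translate likewise (`Iso.toEtale` / `Iso.ofEtale`).
2. Reading the reference model of `S` through the dictionary (`ThetaSetting.modelEnv S`), EVERY
   `M : MonoThetaEnv S` is [EtTh]-isomorphic to it (`nonempty_toEtale_iso_modelEnv`); hence, as soon as the
   reference model of `S` IS a model mono-theta environment of some `T : ThetaEnvData S.N` in t2's sense
   (`ModelAgreement S T` — a HYPOTHESIS on the pair `(S, T)`, discharged below for the setting BUILT from
   `T`), every `M : MonoThetaEnv S` satisfies `T.IsMonoThetaEnv M.toEtale` (`isMonoThetaEnv_toEtale`), and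
   conversely every [EtTh] datum isomorphic to the same model comes from a unique `MonoThetaEnv S`
   (`ofEtale`); for a datum known only to satisfy `T.IsMonoThetaEnv` (possibly via a DIFFERENT cocycle of
   the collection) the converse needs [EtTh] Cor. 2.18 (ii) "model environments of the collection are
   isomorphic" — taken BY NAME as L2's typed fact `ThetaEnvData.Cor218_ii` (`ofIsMonoThetaEnv`).
3. `ThetaSetting.ofThetaEnvData`: the [IUTchII] §1 setting whose reference model IS t2's model
   (`modelPi := Π^tp_Y[μ_N]`, `modelD :=` the `Aut`-form of `D_Y`, `modelTheta :=` the class of `Im s^Θ_η`),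
   the printed side data of p. 20 that `ThetaEnvData` does not carry (`l, p, k ∋ ζ_{4l}`, a topology on
   `G_K`) being explicit parameters (`SideData`); for it `ModelAgreement` holds by `rfl`-level bookkeeping
   (`modelAgreement_ofThetaEnvData`) — so the hypothesis of (2) is satisfiable by the genuine [EtTh] model,
   in particular by L2-t8's `DoubleUnderline.thetaEnvData` built from an [EtTh] §1 theta setting (p407404).

HONEST FRAMING: bookkeeping between two typings of one printed definition; nothing disputed is asserted, no
side is taken on [IUTchIII] Cor. 3.12; typed ≠ discharged. Sources: [IUTchII] §1 p. 20 [claim: Mochizuki2012,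
status: disputed] (IUTchII §1 Def 1.1, kurims p.20) — only its SHAPE is used; [cite: MochizukiEtTh2009, Def 2.13(ii) p.47].
-/

namespace Literature.IUT.HodgeArakelov

universe u

open Literature.AnabelianGeometry.EtaleTheta
open scoped Literature.AnabelianGeometry.EtaleTheta

/-! ## Composition and inversion of [EtTh]-isomorphisms of mono-theta environments -/

namespace MonoThetaBridge

/-- The inverse of an [EtTh] Def. 2.13 (ii) isomorphism of mono-theta environment data.
[cite: MochizukiEtTh2009, Def 2.13(ii) p.48] -/
def etaleIsoSymm {M M' : Literature.AnabelianGeometry.EtaleTheta.MonoThetaEnv.{u}} (α : M.Iso M') : M'.Iso M where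
  e := α.e.symm
  map_D := by
    rw [← α.map_D, Subgroup_map_transport_symm_map_transport]
  map_sTheta := by
    rw [← α.map_sTheta, Set.image_image]
    conv_rhs => rw [← Set.image_id M.sTheta]
    congr 1
    funext H
    change (H.map _).map _ = H
    rw [Subgroup.map_map]
    convert Subgroup.map_id H
    ext x
    change α.e.symm (α.e x) = x
    simp

/-- The composite of two [EtTh] Def. 2.13 (ii) isomorphisms of mono-theta environment data.
[cite: MochizukiEtTh2009, Def 2.13(ii) p.48] -/
def etaleIsoTrans {M M' M'' : Literature.AnabelianGeometry.EtaleTheta.MonoThetaEnv.{u}} (α : M.Iso M') (β : M'.Iso M'') :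
    M.Iso M'' where
  e := α.e.trans β.e
  map_D := by
    rw [TopOut.transport_trans, ← Subgroup.map_map, α.map_D, β.map_D]
  map_sTheta := by
    rw [← β.map_sTheta, ← α.map_sTheta, Set.image_image]
    congr 1
    funext H
    rw [Subgroup.map_map]
    rfl

/-- Equal [EtTh] data are isomorphic (by the identity). [cite: MochizukiEtTh2009, Def 2.13(ii) p.48] -/
def etaleIsoOfEq {M M' : Literature.AnabelianGeometry.EtaleTheta.MonoThetaEnv.{u}} (h : M = M') : M.Iso M' :=
  h ▸ Literature.AnabelianGeometry.EtaleTheta.MonoThetaEnv.Iso.refl M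

end MonoThetaBridge

open MonoThetaBridge

variable {S : ThetaSetting.{u}}

/-! ## The translation of data -/

namespace MonoThetaEnv

/-- `D_Π` of an [IUTchII]-typed mono-theta environment consists of bi-continuous automorphisms.
[claim: Mochizuki2012, status: disputed] (IUTchII §1 Def 1.1, kurims p.20) -/
theorem D_le_contMulAut (M : MonoThetaEnv S) : M.D ≤ contMulAut M.Pi :=
  fun φ hφ => M.D_continuous φ hφ

/-- `D_Π` of an [IUTchII]-typed mono-theta environment contains `Inn(Π)`.
[claim: Mochizuki2012, status: disputed] (IUTchII §1 Def 1.1, kurims p.20) -/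
theorem innerAut_le_D (M : MonoThetaEnv S) : innerAut M.Pi ≤ M.D := M.D_inn

/-- **[IUTchII] ⟶ [EtTh]**: the datum `(Π, D_Π ⊆ Out(Π), s^Θ_Π)` of [EtTh] Def. 2.13 (ii) underlying an
[IUTchII]-typed mono-theta environment (`D_Π` read in `Out` through the dictionary).
[cite: MochizukiEtTh2009, Def 2.13(ii) p.47] -/
abbrev toEtale (M : MonoThetaEnv S) : Literature.AnabelianGeometry.EtaleTheta.MonoThetaEnv.{u} where
  Pi := M.Pi
  D := autToOut M.Pi M.D
  sTheta := M.theta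

/-- Reading `D` back from `Out` recovers the [IUTchII] datum. [cite: MochizukiEtTh2009, Def 2.13(ii) p.47] -/
theorem outToAut_toEtale_D (M : MonoThetaEnv S) : outToAut M.Pi M.toEtale.D = M.D :=
  outToAut_autToOut M.innerAut_le_D M.D_le_contMulAut

end MonoThetaEnv

namespace ThetaSetting

/-- The REFERENCE MODEL of the [IUTchII] §1 setting `S` ("the mod `N` model mono-theta environment
determined by `X̲̲_k`", p. 20), read as an [EtTh] Def. 2.13 (ii) datum.
[claim: Mochizuki2012, status: disputed] (IUTchII §1 Def 1.1, kurims p.20) -/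
abbrev modelEnv (S : ThetaSetting.{u}) : Literature.AnabelianGeometry.EtaleTheta.MonoThetaEnv.{u} where
  Pi := S.modelPi
  D := autToOut S.modelPi S.modelD
  sTheta := S.modelTheta

/-- `modelD` of a setting consists of bi-continuous automorphisms.
[claim: Mochizuki2012, status: disputed] (IUTchII §1, kurims p.20) -/
theorem modelD_le_contMulAut (S : ThetaSetting.{u}) : S.modelD ≤ contMulAut S.modelPi :=
  fun φ hφ => S.modelD_continuous φ hφ

/-- Reading `modelD` back from `Out` recovers it. [claim: Mochizuki2012, status: disputed] (IUTchII §1, kurims p.20) -/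
theorem outToAut_modelEnv_D (S : ThetaSetting.{u}) : outToAut S.modelPi S.modelEnv.D = S.modelD :=
  outToAut_autToOut S.modelD_inn S.modelD_le_contMulAut

end ThetaSetting

namespace MonoThetaEnv

/-- **Translation of isomorphisms, [IUTchII] ⟶ [EtTh]**: an isomorphism of [IUTchII]-typed mono-theta
environments (transporting `D ⊆ Aut` by `MulAut.congr`) is an [EtTh] Def. 2.13 (ii) isomorphism of the
underlying data (transporting `D ⊆ Out` by `TopOut.transport`). [cite: MochizukiEtTh2009, Def 2.13(ii) p.48] -/
def Iso.toEtale {M M' : MonoThetaEnv S} (α : MonoThetaEnv.Iso M M') : M.toEtale.Iso M'.toEtale where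
  e := α.iso
  map_D := by
    change (autToOut M.Pi M.D).map _ = autToOut M'.Pi M'.D
    rw [← autToOut_map_congr α.iso M.D_le_contMulAut, α.map_D]
  map_sTheta := α.map_theta

/-- **Translation of isomorphisms, [EtTh] ⟶ [IUTchII]**. [cite: MochizukiEtTh2009, Def 2.13(ii) p.48] -/
def Iso.ofEtale {M M' : MonoThetaEnv S} (β : M.toEtale.Iso M'.toEtale) : MonoThetaEnv.Iso M M' where
  iso := β.e
  map_D := by
    have h := congrArg (outToAut M'.Pi) β.map_D
    rw [outToAut_map_transport, M.outToAut_toEtale_D, M'.outToAut_toEtale_D] at h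
    exact h
  map_theta := β.map_sTheta

/-- The translations of isomorphisms keep the underlying map. [cite: MochizukiEtTh2009, Def 2.13(ii) p.48] -/
@[simp] theorem Iso.toEtale_e {M M' : MonoThetaEnv S} (α : MonoThetaEnv.Iso M M') : α.toEtale.e = α.iso := rfl

/-- The translations of isomorphisms keep the underlying map. [cite: MochizukiEtTh2009, Def 2.13(ii) p.48] -/
@[simp] theorem Iso.ofEtale_iso {M M' : MonoThetaEnv S} (β : M.toEtale.Iso M'.toEtale) :
    (Iso.ofEtale β).iso = β.e := rfl

/-- **Every [IUTchII]-typed mono-theta environment is [EtTh]-isomorphic to the reference model of its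
setting** (its field `isModel`, read through the dictionary). [claim: Mochizuki2012, status: disputed] (IUTchII §1 Def 1.1, kurims p.20) -/
theorem nonempty_toEtale_iso_modelEnv (M : MonoThetaEnv S) : Nonempty (M.toEtale.Iso S.modelEnv) := by
  obtain ⟨e, hD, hθ⟩ := M.isModel
  refine ⟨{ e := e, map_D := ?_, map_sTheta := hθ }⟩
  change (autToOut M.Pi M.D).map _ = autToOut S.modelPi S.modelD
  rw [← autToOut_map_congr e M.D_le_contMulAut, hD]

/-- **[EtTh] ⟶ [IUTchII]**: an [EtTh] datum `(Π, D_Π ⊆ Out(Π), s^Θ_Π)` isomorphic to the reference model of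
`S` IS an [IUTchII]-typed mono-theta environment of the setting `S` (`D_Π` read in `Aut` through the
dictionary; `Π` re-bundled as a topological group, the topological-group axioms transferred from the model
along the isomorphism). [claim: Mochizuki2012, status: disputed] (IUTchII §1 Def 1.1, kurims p.20) -/
noncomputable def ofEtale (M' : Literature.AnabelianGeometry.EtaleTheta.MonoThetaEnv.{u}) (h : Nonempty (M'.Iso S.modelEnv)) :
    MonoThetaEnv S where
  Pi := @TopGroup.mk M'.Pi _ _ (isTopologicalGroup_of_continuousMulEquiv h.some.e)
  D := outToAut M'.Pi M'.D
  D_inn := @innerAut_le_outToAut _ _ _ (isTopologicalGroup_of_continuousMulEquiv h.some.e) M'.D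
  D_continuous := fun _ hφ => continuous_of_mem_outToAut hφ
  theta := M'.sTheta
  isModel := by
    haveI : IsTopologicalGroup M'.Pi := isTopologicalGroup_of_continuousMulEquiv h.some.e
    obtain ⟨α⟩ := h
    refine ⟨α.e, ?_, α.map_sTheta⟩
    have hmap := congrArg (outToAut S.modelPi) α.map_D
    rw [outToAut_map_transport, S.outToAut_modelEnv_D] at hmap
    exact hmap

/-- `ofEtale` then `toEtale` is the identity ON THE NOSE. [cite: MochizukiEtTh2009, Def 2.13(ii) p.47] -/
theorem toEtale_ofEtale (M' : Literature.AnabelianGeometry.EtaleTheta.MonoThetaEnv.{u}) (h : Nonempty (M'.Iso S.modelEnv)) :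
    (ofEtale M' h).toEtale = M' := by
  cases M' with
  | mk Pi D sTheta =>
    exact congrArg (fun D' : Subgroup (TopOut Pi) => Literature.AnabelianGeometry.EtaleTheta.MonoThetaEnv.mk Pi D' sTheta)
      (autToOut_outToAut D)

/-- `toEtale` then `ofEtale` is the identity ON THE NOSE. [cite: MochizukiEtTh2009, Def 2.13(ii) p.47] -/
theorem ofEtale_toEtale (M : MonoThetaEnv S) (h : Nonempty (M.toEtale.Iso S.modelEnv)) :
    ofEtale M.toEtale h = M := by
  cases M with
  | mk Pi D D_inn D_cont theta isModel =>
    simp only [ofEtale, toEtale]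
    congr 1
    exact outToAut_autToOut D_inn (fun φ hφ => D_cont φ hφ)

end MonoThetaEnv

/-! ## Agreement of the reference model with an [EtTh] model, and `IsMonoThetaEnv` -/

/-- HYPOTHESIS STRUCTURE **"the reference model of `S` is t2's model"**: the reference model of the
[IUTchII] §1 setting `S`, read as an [EtTh] datum, is isomorphic to the model mono-theta environment
`T.modelMono hη` of `T : ThetaEnvData S.N` for a member `η` of the collection of theta cocycles. (For the
setting BUILT from `T` this holds with the identity map: `modelAgreement_ofThetaEnvData`.)
[cite: MochizukiEtTh2009, Def 2.13(ii) p.47] -/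
structure ModelAgreement (S : ThetaSetting.{u}) (T : ThetaEnvData.{u} S.N) : Type u where
  /-- the cocycle of the collection -/
  η : T.PiYdd → T.mu
  mem : η ∈ T.thetaCocycles
  /-- the identification of the two models -/
  iso : S.modelEnv.Iso (T.modelMono mem)

variable {T : ThetaEnvData.{u} S.N}

/-- **[IUTchII] mono-theta environments ARE [EtTh] mono-theta environments**: under `ModelAgreement S T`,
every `M : MonoThetaEnv S` satisfies t2's `T.IsMonoThetaEnv M.toEtale` ([EtTh] Def. 2.13 (ii)).
[cite: MochizukiEtTh2009, Def 2.13(ii) p.47] -/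
theorem isMonoThetaEnv_toEtale (A : ModelAgreement S T) (M : MonoThetaEnv S) :
    T.IsMonoThetaEnv M.toEtale := by
  obtain ⟨α⟩ := M.nonempty_toEtale_iso_modelEnv
  exact ⟨A.η, A.mem, ⟨etaleIsoTrans α A.iso⟩⟩

/-- **Converse, same cocycle**: under `ModelAgreement S T` at the cocycle `η`, every [EtTh] datum isomorphic
to `T.modelMono η` comes from an [IUTchII]-typed mono-theta environment of `S` (namely `ofEtale`).
[cite: MochizukiEtTh2009, Def 2.13(ii) p.47] -/
theorem nonempty_iso_modelEnv_of_iso_modelMono (A : ModelAgreement S T) (M' : Literature.AnabelianGeometry.EtaleTheta.MonoThetaEnv.{u})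
    (h : Nonempty (M'.Iso (T.modelMono A.mem))) : Nonempty (M'.Iso S.modelEnv) := by
  obtain ⟨β⟩ := h
  exact ⟨etaleIsoTrans β (etaleIsoSymm A.iso)⟩

/-- **Converse, any cocycle** (modulo [EtTh] Cor. 2.18 (ii), L2's named fact `ThetaEnvData.Cor218_ii`:
the model environments attached to the members of the collection are mutually isomorphic): under
`ModelAgreement S T`, every datum with `T.IsMonoThetaEnv` is isomorphic to the reference model of `S`, hence
is `(ofEtale …).toEtale`. [cite: MochizukiEtTh2009, Cor 2.18(ii) p.60] -/
theorem nonempty_iso_modelEnv_of_isMonoThetaEnv (hT : T.Cor218_ii) (A : ModelAgreement S T)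
    (M' : Literature.AnabelianGeometry.EtaleTheta.MonoThetaEnv.{u}) (h : T.IsMonoThetaEnv M') : Nonempty (M'.Iso S.modelEnv) := by
  obtain ⟨η', hη', ⟨β⟩⟩ := h
  obtain ⟨γ, -⟩ := hT η' A.η hη' A.mem
  exact ⟨etaleIsoTrans (etaleIsoTrans β γ) (etaleIsoSymm A.iso)⟩

/-- **The [IUTchII]-typed environment of an [EtTh] mono-theta environment** (any cocycle; modulo
`Cor218_ii` as above). [cite: MochizukiEtTh2009, Def 2.13(ii) p.47] -/
noncomputable def MonoThetaEnv.ofIsMonoThetaEnv (hT : T.Cor218_ii) (A : ModelAgreement S T)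
    (M' : Literature.AnabelianGeometry.EtaleTheta.MonoThetaEnv.{u}) (h : T.IsMonoThetaEnv M') : MonoThetaEnv S :=
  MonoThetaEnv.ofEtale M' (nonempty_iso_modelEnv_of_isMonoThetaEnv hT A M' h)

/-- Summary, **the [IUTchII] notion = the [EtTh] notion** (under `ModelAgreement`, modulo `Cor218_ii` for
the backward inclusion): an [EtTh] datum is `T.IsMonoThetaEnv` iff it is the underlying datum of some
[IUTchII]-typed `MonoThetaEnv S`. [cite: MochizukiEtTh2009, Def 2.13(ii) p.47] -/
theorem isMonoThetaEnv_iff_exists_toEtale (hT : T.Cor218_ii) (A : ModelAgreement S T)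
    (M' : Literature.AnabelianGeometry.EtaleTheta.MonoThetaEnv.{u}) :
    T.IsMonoThetaEnv M' ↔ ∃ M : MonoThetaEnv S, M.toEtale = M' := by
  constructor
  · intro h
    exact ⟨MonoThetaEnv.ofIsMonoThetaEnv hT A M' h, MonoThetaEnv.toEtale_ofEtale M' _⟩
  · rintro ⟨M, rfl⟩
    exact isMonoThetaEnv_toEtale A M

/-! ## The [IUTchII] §1 setting built from `T : ThetaEnvData N` -/

namespace ThetaSetting

/-- The printed side data of [IUTchII] §1 p. 20 that t2's `ThetaEnvData N` does not carry: "`l` an odd prime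
number; `k` an MLF of odd residue characteristic `p ≠ l` that contains a primitive `4l`-th root of unity"
(the field as a bare field, as in `ThetaSetting`), and — `G_K` being an abstract group in t2's interface —
the continuity of the augmentation `Π^tp_X ↠ G_K` for a chosen topological-group structure on `G_K`
(instance parameters).
[claim: Mochizuki2012, status: disputed] (IUTchII §1, kurims p.20) -/
structure SideData {N : ℕ+} (T : ThetaEnvData.{u} N) [TopologicalSpace T.G] : Type (u + 1) where
  /-- the odd prime `l` -/
  l : ℕ
  l_prime : l.Prime
  l_odd : l ≠ 2
  /-- the residue characteristic `p` of `k` -/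
  p : ℕ
  p_prime : p.Prime
  p_odd : p ≠ 2
  p_ne_l : p ≠ l
  /-- the MLF `k` (bare field) -/
  k : Type u
  [field : Field k]
  [charZero : CharZero k]
  /-- "`k` contains a primitive `4l`-th root of unity" -/
  hasPrimitiveRoot : ∃ ζ : k, IsPrimitiveRoot ζ (4 * l)
  /-- the augmentation is continuous for the given topology on `G_K` -/
  aug_continuous : Continuous T.aug
  /-- the member of the collection of theta cocycles singled out as `s^Θ` of THE model ([EtTh] Def. 2.13
  (ii)(c); any member — cf. `Cor218_ii`) -/
  η : T.PiYdd → T.mu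
  mem : η ∈ T.thetaCocycles

/-- **The [IUTchII] §1 setting determined by `T : ThetaEnvData N`** (+ side data): `Π^tp_{X̲̲_k} := T.PiX`,
`G_k := T.G`, and the REFERENCE MODEL := t2's model mono-theta environment `T.modelMono η` —
`modelPi := Π^tp_Y[μ_N]` (a topological group by L2's `isTopologicalGroup_env`), `modelD :=` the `Aut`-form
of `D_Y`, `modelTheta :=` the `μ_N`-conjugacy class of `Im s^Θ_η`.
[claim: Mochizuki2012, status: disputed] (IUTchII §1, kurims p.20) -/
noncomputable def ofThetaEnvData {N : ℕ+} (T : ThetaEnvData.{u} N) [TopologicalSpace T.G]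
    [IsTopologicalGroup T.G] (X : SideData T) : ThetaSetting.{u} :=
  { N := N
    l := X.l
    l_prime := X.l_prime
    l_odd := X.l_odd
    p := X.p
    p_prime := X.p_prime
    p_odd := X.p_odd
    p_ne_l := X.p_ne_l
    k := X.k
    field := X.field
    charZero := X.charZero
    hasPrimitiveRoot := X.hasPrimitiveRoot
    PiX := TopGroup.of T.PiX
    Gk := TopGroup.of T.G
    aug := T.aug
    aug_continuous := X.aug_continuous
    aug_surjective := T.aug_surjective
    modelPi := @TopGroup.mk T.env _ _ T.isTopologicalGroup_env
    modelD := outToAut T.env T.DY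
    modelD_inn := @innerAut_le_outToAut _ _ _ T.isTopologicalGroup_env T.DY
    modelD_continuous := fun _ hφ => continuous_of_mem_outToAut hφ
    modelTheta := (T.modelMono X.mem).sTheta }

/-- The level of the setting built from `T : ThetaEnvData N` is `N`.
[claim: Mochizuki2012, status: disputed] (IUTchII §1, kurims p.20) -/
@[simp] theorem ofThetaEnvData_N {N : ℕ+} (T : ThetaEnvData.{u} N) [TopologicalSpace T.G]
    [IsTopologicalGroup T.G] (X : SideData T) :
    (ofThetaEnvData T X).N = N := rfl

/-- The reference model of the setting built from `T` IS t2's model `T.modelMono η`, read through the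
dictionary (equality of [EtTh] data ON THE NOSE). [cite: MochizukiEtTh2009, Def 2.13(ii) p.47] -/
theorem modelEnv_ofThetaEnvData {N : ℕ+} (T : ThetaEnvData.{u} N) [TopologicalSpace T.G]
    [IsTopologicalGroup T.G] (X : SideData T) :
    (ofThetaEnvData T X).modelEnv = T.modelMono X.mem :=
  congrArg (fun D' : Subgroup (TopOut T.env) =>
      Literature.AnabelianGeometry.EtaleTheta.MonoThetaEnv.mk T.env D' (CycEnvelope.muConjClass T.augY T.chi (T.sTheta X.mem).range))
    (autToOut_outToAut T.DY)

/-- **`ModelAgreement` holds for the setting built from `T`** (with the identity isomorphism): the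
hypothesis of `isMonoThetaEnv_toEtale` / `isMonoThetaEnv_iff_exists_toEtale` is satisfied by the genuine
[EtTh] model. [cite: MochizukiEtTh2009, Def 2.13(ii) p.47] -/
noncomputable def modelAgreement_ofThetaEnvData {N : ℕ+} (T : ThetaEnvData.{u} N) [TopologicalSpace T.G]
    [IsTopologicalGroup T.G] (X : SideData T) :
    ModelAgreement (ofThetaEnvData T X) T where
  η := X.η
  mem := X.mem
  iso := etaleIsoOfEq (modelEnv_ofThetaEnvData T X)

/-- Hence, for the setting built from `T`: every [IUTchII]-typed mono-theta environment IS an [EtTh]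
mono-theta environment of `T` — UNCONDITIONALLY. [cite: MochizukiEtTh2009, Def 2.13(ii) p.47] -/
theorem isMonoThetaEnv_toEtale_ofThetaEnvData {N : ℕ+} (T : ThetaEnvData.{u} N) [TopologicalSpace T.G]
    [IsTopologicalGroup T.G] (X : SideData T)
    (M : MonoThetaEnv (ofThetaEnvData T X)) : T.IsMonoThetaEnv M.toEtale :=
  isMonoThetaEnv_toEtale (modelAgreement_ofThetaEnvData T X) M

/-- … and t2's model itself is (the underlying datum of) an [IUTchII]-typed mono-theta environment of that
setting — a NON-VACUITY witness for `MonoThetaEnv (ofThetaEnvData T X)`.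
[cite: MochizukiEtTh2009, Def 2.13(ii) p.47] -/
theorem nonempty_monoThetaEnv_ofThetaEnvData {N : ℕ+} (T : ThetaEnvData.{u} N) [TopologicalSpace T.G]
    [IsTopologicalGroup T.G] (X : SideData T) :
    ∃ M : MonoThetaEnv (ofThetaEnvData T X), M.toEtale = T.modelMono X.mem :=
  ⟨MonoThetaEnv.ofEtale (T.modelMono X.mem) ⟨etaleIsoOfEq (modelEnv_ofThetaEnvData T X).symm⟩,
    MonoThetaEnv.toEtale_ofEtale _ _⟩

/-- For the setting built from `T`, modulo `Cor218_ii`: t2's `IsMonoThetaEnv` = "underlies an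
[IUTchII]-typed `MonoThetaEnv`". [cite: MochizukiEtTh2009, Cor 2.18(ii) p.60] -/
theorem isMonoThetaEnv_iff_ofThetaEnvData {N : ℕ+} (T : ThetaEnvData.{u} N) [TopologicalSpace T.G]
    [IsTopologicalGroup T.G] (X : SideData T)
    (hT : T.Cor218_ii) (M' : Literature.AnabelianGeometry.EtaleTheta.MonoThetaEnv.{u}) :
    T.IsMonoThetaEnv M' ↔ ∃ M : MonoThetaEnv (ofThetaEnvData T X), M.toEtale = M' :=
  isMonoThetaEnv_iff_exists_toEtale hT (modelAgreement_ofThetaEnvData T X) M'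

end ThetaSetting

end Literature.IUT.HodgeArakelov
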